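import Literature.Analysis.FluidPDE.WholeSpaceIBP
import Literature.Analysis.FluidPDE.VorticityStretching
import Literature.Analysis.FluidPDE.LocalBiotSavartCalculus
import Literature.Analysis.FluidPDE.SteadyDSolutionPressureLimit
import Summits.NavierStokesRegularity.NavierStokesRegularity.Theorems.ThreadingFluxCentreVirialDefs
import Summits.NavierStokesRegularity.NavierStokesRegularity.Theorems.ThreadingFluxCentreJetSteadyFacts
import HarnessLib

/-!
# Crux `PoloidalLiouville` (stmt-NavierStokesRegularity-1222, W1), crux idea «centre-virial» (ns-idea-15 g9):
# the literature inputs F1/F2 DISCHARGED and the centre-virial identity V1, by name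

Proof file over the Theorems-side twin `ThreadingFluxCentreVirialDefs` of `Cruxes/PoloidalLiouville/CentreVirialSketch.lean`
v1.1 (verdict V25 PASS-WITH-PRICE).  The card carried Galdi's pressure limit (F1) and the non-positive head (F2) as HYPOTHESES;
both are THEOREMS of the tree, and this file says so by name:

* `isDSolution_lit_of_isDSolution`, `isDSolution_iff_lit` (over the tree's `CentreJet.isSteadyNSSolution_of_isSteadyNSOn`,
  `ThreadingFluxCentreJetSteadyFacts`) — the class bridge, both
  directions: the card's `IsDSolution u p` (classical steady NS on `ℝ³`, `u ∈ C³`, `p ∈ C¹`, integrable `|∇u|²`, `u → 0`)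
  is EQUIVALENT to «`Literature.Analysis.FluidPDE.IsDSolution 1 0 u p` + `u → 0` at infinity» (the converse by elliptic
  regularity `IsSteadyNSSolution.contDiff_velocity_infty`);
* `dSolutionPressureLimit : DSolutionPressureLimit` (F1) from `IsDSolution.exists_tendsto_pressure` (Galdi 2011 Thm X.5.1 /
  Wang 2025 Thm 2.1, order-zero pressure clause, PROVED in `SteadyDSolutionPressureLimit.lean`);
* `headNonpositive : HeadNonpositive` (F2) from `headPressure_le_of_tendsto` (Chae–Weng 2016 Lemma 3.1: Tsai's identity
  `ΔΠ − u·∇Π = |curl u|² ≥ 0` + the perturbed weak maximum principle on large balls);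
* `centreVirialIdentity : CentreVirialIdentity` (V1): `div(p y + m u + curl u × y) = 3p + |u|²` pointwise for every classical
  steady flow — Korobkov–Pileckas–Russo's test-field identity re-centred from cylinders to spheres.

Information-grade; W1 movement 0; `PoloidalLiouville` (1222), T0, Galdi's problem OPEN; NS regularity is NOT proved.
`--supports stmt-NavierStokesRegularity-1222 --as helper`.  Filed by ns-wall-eng-4 g6 (cell ns-wall-extremal).
[cite: Galdi2011, Thm X.5.1] [cite: ChaeWeng2016, Lemma 3.1] [cite: KorobkovPileckasRusso2015, Thm 3.6]
-/

-- the summit and its single sub-problem share the name (CONVENTIONS §1)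
set_option linter.dupNamespace false

noncomputable section

namespace Summit.NavierStokesRegularity.NavierStokesRegularity.Theorems.PoloidalLiouville.CentreVirial

open Set Function MeasureTheory Filter Topology
open Literature.Analysis.FluidPDE
open Literature.Analysis.FluidPDE.VectorCalculus (divergence IsDivFree)
open Summit.NavierStokesRegularity.NavierStokesRegularity.Theorems.PoloidalLiouville.CentreJet
  (E3 IsUnthreadedAbout IsSteadyNSOn)
open scoped RealInnerProductSpace

/-! ## F — the class bridge; F1 and F2 discharged -/

/-- **Class bridge.**  A `D`-solution in the sense of the card (`IsDSolution u p`: classical steady NS on `ℝ³`, integrable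
`|∇u|²`, `u → 0` at infinity) is a `D`-solution of the `ν = 1` unforced system in the sense of
`Literature.Analysis.FluidPDE.IsDSolution 1 0 u p` (finite extended Dirichlet integral). -/
theorem isDSolution_lit_of_isDSolution {u : E3 → E3} {p : E3 → ℝ} (h : IsDSolution u p) :
    Literature.Analysis.FluidPDE.IsDSolution 1 0 u p :=
  ⟨CentreJet.isSteadyNSSolution_of_isSteadyNSOn h.1, h.2.1.lintegral_lt_top⟩

/-- **Class bridge, both directions.**  The card's `IsDSolution u p` is EQUIVALENT to «Literature `D`-solution of the
`ν = 1` unforced steady system + decay `u → 0` at infinity»: `⇒` is `isDSolution_lit_of_isDSolution`; `⇐` uses that `C²`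
steady solutions on `ℝ³` are smooth (`IsSteadyNSSolution.contDiff_velocity_infty`, so the card's `C³` is no restriction) and
that a continuous nonnegative function with finite lower integral is integrable. -/
theorem isDSolution_iff_lit {u : E3 → E3} {p : E3 → ℝ} :
    IsDSolution u p ↔
      Literature.Analysis.FluidPDE.IsDSolution 1 0 u p ∧ Tendsto u (cocompact E3) (𝓝 0) := by
  constructor
  · exact fun h => ⟨isDSolution_lit_of_isDSolution h, h.2.2⟩
  · rintro ⟨hD, hdec⟩
    have hS : IsSteadyNSSolution 1 0 u p := hD.isSteadyNSSolution
    have hu : ContDiff ℝ (⊤ : ℕ∞) u := hS.contDiff_velocity_infty one_ne_zero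
    refine ⟨⟨?_, contDiffOn_univ.mpr hS.contDiff_pressure, fun x _ => hS.divFree x, fun x _ => ?_⟩, ?_, hdec⟩
    · exact contDiffOn_univ.mpr (hu.of_le (by norm_cast))
    · have e := hS.momentum x
      rw [one_smul, convect_apply, Pi.zero_apply] at e
      rw [← sub_eq_zero, ← e]
      abel
    · have hc : Continuous fun x => frobeniusNormSq (fderiv ℝ u x) := by
        have h1 : Continuous (fderiv ℝ u) := hu.continuous_fderiv (by simp)
        have e : (fun x => frobeniusNormSq (fderiv ℝ u x)) =
            fun x => ∑ i, ‖fderiv ℝ u x (EuclideanSpace.basisFun (Fin 3) ℝ i)‖ ^ 2 :=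
          funext fun x => frobeniusNormSq_eq_sum (EuclideanSpace.basisFun (Fin 3) ℝ) _
        rw [e]
        exact continuous_finsetSum _ fun i _ => ((h1.clm_apply continuous_const).norm).pow 2
      exact ⟨hc.aestronglyMeasurable,
        (hasFiniteIntegral_iff_ofReal (ae_of_all _ fun x => frobeniusNormSq_nonneg _)).2 hD.dirichlet_lt_top⟩

/-- **(F1) `DSolutionPressureLimit` — DISCHARGED**: the pressure of a `D`-solution tending to `0` at infinity has a limit
at infinity.  By name from the tree's PROVED order-zero pressure clause of Galdi 2011 Thm X.5.1 / Wang 2025 Thm 2.1,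
`Literature.Analysis.FluidPDE.IsDSolution.exists_tendsto_pressure`. [cite: Galdi2011, Thm X.5.1] -/
theorem dSolutionPressureLimit : DSolutionPressureLimit := by
  intro u p hD
  exact (isDSolution_lit_of_isDSolution hD).exists_tendsto_pressure one_pos hD.2.2

/-- **(F2) `HeadNonpositive` — DISCHARGED**: for a `D`-solution with `p → p₀` at infinity the Bernoulli head satisfies
`p − p₀ + |u|²/2 ≤ 0` everywhere.  By name from the tree: steady `C²` solutions are smooth
(`IsSteadyNSSolution.contDiff_velocity_infty`), and the weak maximum principle for the head pressure of a decaying steady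
solution `headPressure_le_of_tendsto` (Tsai's identity `ΔΠ − u·∇Π = |curl u|² ≥ 0` + perturbed maximum principle on large
balls). [cite: ChaeWeng2016, Lemma 3.1] -/
theorem headNonpositive : HeadNonpositive := by
  intro u p p₀ hD hp x
  have hS : IsSteadyNSSolution 1 0 u p := CentreJet.isSteadyNSSolution_of_isSteadyNSOn hD.1
  have hU : ContDiff ℝ (⊤ : ℕ∞) u := hS.contDiff_velocity_infty one_ne_zero
  have h := headPressure_le_of_tendsto one_pos hS.isLerayProfile_zero hU hD.2.2 hp x
  linarith

/-! ## V1 — the centre-virial identity -/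

/-- **(V1) `CentreVirialIdentity` — the centre-virial identity holds**: for a classical steady Navier–Stokes flow
`(u, p)` on `ℝ³` and every centre `x₀`, the flux field `F = p·y + m·u + curl u × y` (`y = x − x₀`, `m = ⟪y, u⟫`) has
`div F = 3p + |u|²` pointwise.  Product rule: `div(p y) = 3p + ⟪y, ∇p⟫`, `div(m u) = m div u + Dm[u] = |u|² + ⟪y, Du u⟫`,
`div(ω × y) = ⟪y, curl ω⟫ − ⟪ω, curl y⟫ = −⟪y, Δu⟫` (`curl curl = −Δ` on divergence-free fields, `curl y = 0`); the three
`y`-terms add up to `⟪y, Du u + ∇p − Δu⟫ = 0` by the momentum equation.  (Korobkov–Pileckas–Russo's test-field identity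
re-centred from cylinders to spheres; idea-15 g9 card «centre-virial», (V1).) [cite: KorobkovPileckasRusso2015, Thm 3.6] -/
theorem centreVirialIdentity : CentreVirialIdentity := by
  intro u p x₀ h x
  have hu3 : ContDiff ℝ 3 u := contDiffOn_univ.mp h.1
  have hu2 : ContDiff ℝ 2 u := hu3.of_le (by norm_num)
  have hp1 : ContDiff ℝ 1 p := contDiffOn_univ.mp h.2.1
  have hdiv : IsDivFree u := fun y => h.2.2.1 y (mem_univ y)
  have hNS : fderiv ℝ u x (u x) + gradient p x = Laplacian.laplacian u x := h.2.2.2 x (mem_univ x)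
  -- differentiability at `x`
  have hud : DifferentiableAt ℝ u x := hu3.differentiable (by norm_num) x
  have hpd : DifferentiableAt ℝ p x := hp1.differentiable one_ne_zero x
  have hyd : DifferentiableAt ℝ (fun y : E3 => y - x₀) x := differentiableAt_id.sub_const x₀
  have hmd : DifferentiableAt ℝ (mom x₀ u) x := hyd.inner ℝ hud
  have hcurl1 : ContDiff ℝ 1 (curl u) := by
    rw [curl_eq_curlCLM_comp]
    exact curlCLM.contDiff.comp (hu2.fderiv_right le_rfl)
  have hcd : DifferentiableAt ℝ (curl u) x := hcurl1.differentiable one_ne_zero x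
  have hfd_y : fderiv ℝ (fun y : E3 => y - x₀) x = ContinuousLinearMap.id ℝ E3 := by
    rw [fderiv_sub_const, fderiv_fun_id]
  -- additivity of the divergence at a point
  have hadd : ∀ f g : E3 → E3, DifferentiableAt ℝ f x → DifferentiableAt ℝ g x →
      divergence (fun y => f y + g y) x = divergence f x + divergence g x := by
    intro f g hf hg
    unfold VectorCalculus.divergence
    rw [fderiv_fun_add hf hg, ContinuousLinearMap.toLinearMap_add, map_add]
  -- term 1: `div (p y) = 3p + ⟪y, ∇p⟫`
  have t1 : divergence (fun y => p y • (y - x₀)) x = 3 * p x + ⟪x - x₀, gradient p x⟫ := by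
    rw [divergence_smul_apply hpd hyd]
    have h3 : divergence (fun y : E3 => y - x₀) x = 3 := by
      unfold VectorCalculus.divergence
      rw [hfd_y]
      have ht := LinearMap.trace_id ℝ E3
      rw [finrank_euclideanSpace_fin] at ht
      exact_mod_cast ht
    rw [h3]
    ring
  -- term 2: `div (m u) = |u|² + ⟪y, Du u⟫`
  have t2 : divergence (fun y => mom x₀ u y • u y) x = ‖u x‖ ^ 2 + ⟪x - x₀, fderiv ℝ u x (u x)⟫ := by
    rw [divergence_smul_apply hmd hud, hdiv x, mul_zero, zero_add, ← real_inner_comm, gradient,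
      InnerProductSpace.toDual_symm_apply]
    show fderiv ℝ (fun y => ⟪y - x₀, u y⟫) x (u x) = ‖u x‖ ^ 2 + ⟪x - x₀, fderiv ℝ u x (u x)⟫
    rw [fderiv_inner_apply ℝ hyd hud, hfd_y, ContinuousLinearMap.id_apply, real_inner_self_eq_norm_sq]
    ring
  -- term 3: `div (ω × y) = −⟪y, Δu⟫`
  have t3 : divergence (fun y => cross (curl u y) (y - x₀)) x = -⟪x - x₀, Laplacian.laplacian u x⟫ := by
    rw [divergence_cross_holds (curl u) (fun y => y - x₀) x hcd hyd, curl_curl_eq_neg_laplacian hu2 hdiv x]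
    have hc0 : curl (fun y : E3 => y - x₀) x = 0 := by
      rw [curl_eq_curlCLM, hfd_y, curlCLM_apply]
      ext i
      fin_cases i <;> simp
    rw [hc0, inner_zero_right, sub_zero, inner_neg_right]
  -- assemble
  have hF : virialField x₀ u p = fun y => (p y • (y - x₀) + mom x₀ u y • u y) + cross (curl u y) (y - x₀) := rfl
  have hd12 : DifferentiableAt ℝ (fun y => p y • (y - x₀) + mom x₀ u y • u y) x :=
    (hpd.smul hyd).add (hmd.smul hud)
  have hd3 : DifferentiableAt ℝ (fun y => cross (curl u y) (y - x₀)) x :=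
    (hasFDerivAt_cross hcd.hasFDerivAt hyd.hasFDerivAt).differentiableAt
  have e12 : divergence (fun y => p y • (y - x₀) + mom x₀ u y • u y) x =
      divergence (fun y => p y • (y - x₀)) x + divergence (fun y => mom x₀ u y • u y) x :=
    hadd (fun y => p y • (y - x₀)) (fun y => mom x₀ u y • u y) (hpd.smul hyd) (hmd.smul hud)
  rw [hF, hadd _ _ hd12 hd3, e12, t1, t2, t3, ← hNS, inner_add_right]
  ring

end Summit.NavierStokesRegularity.NavierStokesRegularity.Theorems.PoloidalLiouville.CentreVirial
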